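import Mathlib.Data.Int.Basic
import HarnessLib

/-!
# BI 2017, Rem. 3.26 — a kernel-evaluable pruned enumerator for the signed Latin annulus count

Computational infrastructure for the residual numerical verifications of `BI2017_rem_3_26`
(Bürgisser–Ikenmeyer 2017, Rem. 3.26: "We verified that [the number of even `m × (m+1)` Latin
Annuli differs from the number of odd ones] for `m = 1, 3, 5,` and `7`"; the fact is reduced to
`latinAnnulusCount 5 6 ≠ 0 ∧ latinAnnulusCount 7 8 ≠ 0` by `BI2017_rem_3_26_of_counts`, and
`latinAnnulusCount 5 6 = 120 · N₅` with `N₅` the signed count of the normalised annuli by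
`latinAnnulusCount_five_six_eq`).

`LatinAnnulusEnum.enumAux m d fuel done cur` is a depth-first, cell-by-cell (column-major)
enumeration of the fillings of an `m × d` array by the symbols `0, …, m-1`: `done` is the list of
completed columns (most recent first, each a list of `m` symbols, row `0` first), `cur` the partial
current column, `fuel` the number of cells still to fill.  A symbol `v` may be placed in the next
cell `(κ, j)` (`κ = cur.length`, `j = done.length`) iff it does not occur in `cur` and does not
occur in an earlier column `j' = j - t` at the row `κ' = (κ - t) mod d` lying on the same diagonal
(`j' - κ' ≡ j - κ (mod d)`; no condition when `κ' ≥ m`, i.e. when that diagonal misses column `j'`)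
— `okCell`.  When a column is completed its sign `(-1)^{#inversions}` (`colSign`) is multiplied in;
an exhausted `fuel` contributes `1`.  By design (pairwise distinctness along columns and diagonals
is tested exactly once per pair of cells, at the later cell) the value
`enumAux m d (m·d − m) [[0,1,…,m-1]] []` is the signed count of the `m × d` Latin annuli whose
column `0` is the identity, in the parametrisation of `latinAnnulusCount_eq_factorial_mul`; the
SOUNDNESS THEOREM linking `enumAux` to that `Finset` sum is NOT in this file (successor work, see
the cell HANDOFF) — this file provides the definitions, their unfolding lemmas and the small kernel
evaluations `enumAux 3 4 12 [] [] = 24` (the value of `latinAnnulusCount_three_four`) and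
`enumAux 3 4 9 [[0,1,2]] [] = 4`.  The `m = 5` target is `enumAux 5 6 25 [[0,1,2,3,4]] [] = 2304`
(native value; `120 · 2304 = 276480 = latinAnnulusCount 5 6` over `1 128 960` Latin annuli, `9408`
of them normalised; `207 007` search nodes): a ONE-SHOT `decide +kernel` of it runs ≈ 3 minutes but
sits at the kernel's memory bound (one pass, three "excessive memory" failures on the check farm),
so it is certified here in FIVE PIECES (one per entry of row `0` of column `1`,
`enumAux_five_six_piece0 … piece4` = `384, 384, 384, 384, 768`) reassembled by one unfolding step
(`enumAux_five_six_norm`).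

Design notes for the soundness proof: the recursion is structural in `fuel`; each step is a
`List.foldr` of `(term v) + acc` over `List.range m` (= `((List.range m).map term).sum`); the state
is list-based (positional `List.getD` look-ups) because `Function.update` chains and whole-column
`Equiv.Perm` candidates are an order of magnitude slower in the kernel; the column sign is the
inversion parity (`inversions`), to be identified with `Kumar2015.seqSign` / `Equiv.Perm.sign`
(a `seqSign`-valued column sign exhausts kernel memory already in one shot at `m = 5`).  Imports
are minimal on purpose (`Mathlib.Data.Int.Basic`), to keep the kernel evaluations light; files
relating `enumAux` to `latinAnnulusCount` should import this file, not conversely.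

## References
* [BurgisserIkenmeyer2017] P. Bürgisser, C. Ikenmeyer, Fundamental invariants of orbit closures,
  J. Algebra 477 (2017) 390–434, Rem. 3.26.
-/

namespace Literature.Computability.AlgebraicComplexity

namespace LatinAnnulusEnum

/-- The number of entries of `l` that are smaller than `a`. [cite: BurgisserIkenmeyer2017, Rem. 3.26] -/
def countLt (a : ℕ) : List ℕ → ℕ
  | [] => 0
  | b :: l => bif Nat.blt b a then countLt a l + 1 else countLt a l

/-- The number of inversions of a list of naturals: pairs of positions `i < j` with `l[i] > l[j]`.
[cite: BurgisserIkenmeyer2017, Rem. 3.26] -/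
def inversions : List ℕ → ℕ
  | [] => 0
  | a :: l => countLt a l + inversions l

/-- The sign `(-1)^{#inversions}` of a column given as a list of symbols (for a permutation of
`0,…,m-1` this is its signature — "the signs of the permutations in its columns", BI 2017 Rem. 3.26).
[cite: BurgisserIkenmeyer2017, Rem. 3.26] -/
def colSign (l : List ℕ) : ℤ := bif Nat.beq (inversions l % 2) 0 then 1 else -1

/-- Boolean list membership on naturals (via `Nat.beq`). [cite: BurgisserIkenmeyer2017, Rem. 3.26] -/
def memList (v : ℕ) : List ℕ → Bool
  | [] => false
  | b :: l => Nat.beq b v || memList v l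

/-- Diagonal test for placing the symbol `v` in row `κ` of the current column of an `m × d` array,
against the completed columns `done` (most recent first; the head is at distance `t`, the next at
distance `t+1`, …): the cell of column `j - t` on the diagonal through `(κ, j)` is in row
`κ' = (κ + d - t) mod d`; it carries no condition if `κ' ≥ m`, and otherwise must not hold `v`.
[cite: BurgisserIkenmeyer2017, Rem. 3.26] -/
def goDiag (m d κ v : ℕ) : ℕ → List (List ℕ) → Bool
  | _, [] => true
  | t, c :: cs =>
    (let κ' := (κ + d - t) % d
     (Nat.ble m κ' || !(Nat.beq (c.getD κ' m) v))) && goDiag m d κ v (t + 1) cs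

/-- Admissibility of the symbol `v` for the next cell (row `cur.length` of column `done.length`):
not already in the current column, and no clash on its diagonal with the completed columns.
[cite: BurgisserIkenmeyer2017, Rem. 3.26] -/
def okCell (m d : ℕ) (done : List (List ℕ)) (cur : List ℕ) (v : ℕ) : Bool :=
  !(memList v cur) && goDiag m d cur.length v 1 done

/-- The pruned depth-first enumerator (see the module docstring): sum over the admissible symbols
`v < m` for the next cell of the value of the extended state, multiplying by the column sign when a
column is completed; `fuel` = number of cells still to be filled, value `1` at `fuel = 0`.  All
tests are `Bool`-valued on the core `Nat` primitives (`Nat.beq`/`Nat.ble`/`Nat.blt`) for kernel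
evaluation. [cite: BurgisserIkenmeyer2017, Rem. 3.26] -/
def enumAux (m d : ℕ) : ℕ → List (List ℕ) → List ℕ → ℤ
  | 0, _, _ => 1
  | fuel + 1, done, cur =>
    (List.range m).foldr (fun v acc =>
      (bif okCell m d done cur v then
        (bif Nat.beq (cur.length + 1) m then
            colSign (cur ++ [v]) * enumAux m d fuel ((cur ++ [v]) :: done) []
         else enumAux m d fuel done (cur ++ [v]))
      else 0) + acc) 0

/-! ### Unfolding lemmas -/

/-- [cite: BurgisserIkenmeyer2017, Rem. 3.26] -/
theorem enumAux_zero (m d : ℕ) (done : List (List ℕ)) (cur : List ℕ) :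
    enumAux m d 0 done cur = 1 := rfl

/-- The recursion step as a sum over `List.range m`. [cite: BurgisserIkenmeyer2017, Rem. 3.26] -/
theorem enumAux_succ (m d fuel : ℕ) (done : List (List ℕ)) (cur : List ℕ) :
    enumAux m d (fuel + 1) done cur =
      ((List.range m).map fun v =>
        bif okCell m d done cur v then
          (bif Nat.beq (cur.length + 1) m then
              colSign (cur ++ [v]) * enumAux m d fuel ((cur ++ [v]) :: done) []
           else enumAux m d fuel done (cur ++ [v]))
        else 0).sum := by
  rw [enumAux]
  simp only [List.sum, List.foldr_map]

/-- `memList` is list membership. [cite: BurgisserIkenmeyer2017, Rem. 3.26] -/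
theorem memList_eq_true_iff (v : ℕ) (l : List ℕ) : memList v l = true ↔ v ∈ l := by
  induction l with
  | nil => simp [memList]
  | cons b l ih =>
    simp only [memList, Bool.or_eq_true, Nat.beq_eq, ih, List.mem_cons]
    constructor
    · rintro (h | h)
      exacts [Or.inl h.symm, Or.inr h]
    · rintro (h | h)
      exacts [Or.inl h.symm, Or.inr h]

/-- `countLt a l` is the number of entries of `l` below `a`. [cite: BurgisserIkenmeyer2017, Rem. 3.26] -/
theorem countLt_eq_length_filter (a : ℕ) (l : List ℕ) :
    countLt a l = (l.filter (· < a)).length := by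
  induction l with
  | nil => simp [countLt]
  | cons b l ih =>
    by_cases h : b < a
    · have hb : Nat.blt b a = true := Nat.blt_eq.mpr h
      simp [countLt, ih, h, hb]
    · have hb : Nat.blt b a = false := by
        cases hba : Nat.blt b a
        · rfl
        · exact absurd (Nat.blt_eq.mp hba) h
      simp [countLt, ih, h, hb]

/-- `colSign` takes the values `±1`. [cite: BurgisserIkenmeyer2017, Rem. 3.26] -/
theorem colSign_eq_one_or (l : List ℕ) : colSign l = 1 ∨ colSign l = -1 := by
  unfold colSign
  cases Nat.beq (inversions l % 2) 0 <;> simp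

/-! ### Kernel evaluations -/

set_option maxRecDepth 8000

/-- `3 × 4`, all columns free: the signed count `24` of `latinAnnulusCount_three_four`.
[cite: BurgisserIkenmeyer2017, Rem. 3.26] -/
theorem enumAux_three_four : enumAux 3 4 12 [] [] = 24 := by
  decide +kernel

/-- `3 × 4`, column `0` fixed to the identity: `4 = 24 / 3!`. [cite: BurgisserIkenmeyer2017, Rem. 3.26] -/
theorem enumAux_three_four_norm : enumAux 3 4 9 [[0, 1, 2]] [] = 4 := by
  decide +kernel

/-! ### The `m = 5` evaluation, in five pieces

The one-shot kernel evaluation of `enumAux 5 6 25 [[0,1,2,3,4]] []` sits at the kernel's memory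
bound; splitting on the entry in row `0` of column `1` (all five symbols are admissible there: the
diagonal through `(0,1)` misses column `0`) gives five evaluations of a fifth of the size, which are
reassembled by one unfolding step `enumAux_succ`. -/

/-- Piece `v = 0` of the `m = 5` evaluation. [cite: BurgisserIkenmeyer2017, Rem. 3.26] -/
theorem enumAux_five_six_piece0 : enumAux 5 6 24 [[0, 1, 2, 3, 4]] [0] = 384 := by
  decide +kernel

/-- Piece `v = 1` of the `m = 5` evaluation. [cite: BurgisserIkenmeyer2017, Rem. 3.26] -/
theorem enumAux_five_six_piece1 : enumAux 5 6 24 [[0, 1, 2, 3, 4]] [1] = 384 := by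
  decide +kernel

/-- Piece `v = 2` of the `m = 5` evaluation. [cite: BurgisserIkenmeyer2017, Rem. 3.26] -/
theorem enumAux_five_six_piece2 : enumAux 5 6 24 [[0, 1, 2, 3, 4]] [2] = 384 := by
  decide +kernel

/-- Piece `v = 3` of the `m = 5` evaluation. [cite: BurgisserIkenmeyer2017, Rem. 3.26] -/
theorem enumAux_five_six_piece3 : enumAux 5 6 24 [[0, 1, 2, 3, 4]] [3] = 384 := by
  decide +kernel

/-- Piece `v = 4` of the `m = 5` evaluation. [cite: BurgisserIkenmeyer2017, Rem. 3.26] -/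
theorem enumAux_five_six_piece4 : enumAux 5 6 24 [[0, 1, 2, 3, 4]] [4] = 768 := by
  decide +kernel

/-- **The `m = 5` evaluation** (BI 2017 Rem. 3.26, "verified … for `m = 5`"): the pruned
enumeration of the `5 × 6` arrays with column `0` the identity returns `2304`
(`207 007` search nodes, `9408` completed arrays; `120 · 2304 = 276480`, the native value of
`latinAnnulusCount 5 6`). [cite: BurgisserIkenmeyer2017, Rem. 3.26] -/
theorem enumAux_five_six_norm : enumAux 5 6 25 [[0, 1, 2, 3, 4]] [] = 2304 := by
  have hr : List.range 5 = [0, 1, 2, 3, 4] := by decide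
  have hok : ∀ v ∈ [0, 1, 2, 3, 4], okCell 5 6 [[0, 1, 2, 3, 4]] [] v = true := by decide
  rw [enumAux_succ, hr]
  simp only [List.map_cons, List.map_nil, List.sum_cons, List.sum_nil, List.nil_append,
    List.length_nil, hok 0 (by decide), hok 1 (by decide), hok 2 (by decide), hok 3 (by decide),
    hok 4 (by decide), cond_true, show Nat.beq (0 + 1) 5 = false from rfl, cond_false,
    enumAux_five_six_piece0, enumAux_five_six_piece1, enumAux_five_six_piece2,
    enumAux_five_six_piece3, enumAux_five_six_piece4]
  decide

end LatinAnnulusEnum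

end Literature.Computability.AlgebraicComplexity
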